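import Literature.Analysis.UnboundedOperators.SemilinearMildGluing
import Summits.AnomalousDissipation.AnomalousDissipation.Theorems.BaireTransferDenseLoudDesignerForcesErgodicModelDefs

/-!
# The exact local semigroup law of the model map (tools stub `stub_modelSemigroupTools`, block N, S6b,
# line `ergodic-budget-selection-closing`, crux `BaireTransfer.DenseLoudDesignerForces`, stmt-AnomalousDissipation-1143)

Summit-side plumbing over the definitions file `…ErgodicModelDefs.lean` (`ModelFrame`, `ModelFrame.IsMild`,
`ModelFrame.modelMap`) and the abstract bookkeeping of continuous mild solutions on compact intervals
(`Literature/Analysis/UnboundedOperators/SemilinearMildGluing.lean`: uniqueness, restriction, shift, concatenation,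
on top of the Lipschitz stability `SemilinearMildTubeLipschitz.lean` and the Duhamel algebra `SemilinearMildTubeShift.lean`).

For a frame `F : ModelFrame` and a viscosity `ν > 0` the families `T_ν r := F.T (ν r)`, `K_ν r := F.K (ν r)` satisfy the
hypotheses of the abstract theory (`T_mul_add`, `norm_T_mul_le`, `continuous_T_mul`, `norm_K_mul_le` with `α = 3/4`,
`C = ν^{-3/4}`, `K_mul_add`, `continuousOn_K_mul`), so `F.IsMild ν xf` solutions start at their datum, are unique, restrict,
shift and concatenate (`IsMild.apply_zero/unique/restrict/shift/concat`, `isMild_const`).  Consequently the model map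
`g t := F.modelMap ν xf U' t` ("the value at `t` of the mild solution on `[0, t]` staying in `U'`, junk `0` otherwise") is
computed by ANY admissible solution (`modelMap_eq_of_isMild`), is `0` when there is none (`modelMap_eq_zero`), fixes `U'` at
time `0` (`modelMap_zero_apply`), admits admissible solutions along orbit segments that stay in a set `U` from which short-time
admissible solutions exist (`exists_isMild_of_forall_modelMap_mem`), and satisfies the local semigroup law
`g (s + t) y = g s (g t y)` EXACTLY, junk cases included (`stub_modelSemigroupTools`, N-programme §7): both sides are the value
of the concatenated solution when the second leg stays in `U'`, and both are the junk `0` otherwise (a solution on `[0, s + t]`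
would restrict to the solution on `[0, t]` by uniqueness and shift to an admissible second leg).

References: D. Henry, *Geometric Theory of Semilinear Parabolic Equations*, LNM 840 (1981), Thm. 3.3.3, Thm. 3.3.4; A. Pazy,
*Semigroups of Linear Operators and Applications to PDE* (1983), §6.3.  Nothing is asserted; no definition is added.
-/

set_option linter.dupNamespace false

noncomputable section

open Set Function MeasureTheory Filter
open scoped InnerProductSpace

namespace Summit.AnomalousDissipation.AnomalousDissipation.Theorems.DenseLoudDesignerForces.Ergodic

open Literature.Analysis.FunctionSpaces Literature.Analysis.FunctionSpaces.Torus
open Literature.Analysis.FluidPDE Literature.Analysis.FluidPDE.Torus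
open Literature.Analysis.UnboundedOperators

namespace ModelFrame

section FrameLaws

variable (F : ModelFrame)

/-- `T_ν 0 = 1` for the rescaled semigroup `T_ν r := T(ν r)`. [folklore] -/
theorem T_mul_zero (ν : ℝ) : F.T (ν * 0) = 1 := by
  rw [mul_zero]; exact F.hT0

/-- The semigroup law of the rescaled semigroup `T_ν r := T(ν r)`, `ν ≥ 0`. [folklore] -/
theorem T_mul_add {ν : ℝ} (hν : 0 ≤ ν) :
    ∀ s t : ℝ, 0 ≤ s → 0 ≤ t → F.T (ν * (s + t)) = (F.T (ν * s)).comp (F.T (ν * t)) := fun s t hs ht => by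
  rw [mul_add]; exact F.hTadd _ _ (mul_nonneg hν hs) (mul_nonneg hν ht)

/-- The rescaled semigroup consists of contractions. [folklore] -/
theorem norm_T_mul_le {ν : ℝ} (hν : 0 ≤ ν) : ∀ t : ℝ, 0 ≤ t → ‖F.T (ν * t)‖ ≤ 1 := fun t ht =>
  F.hTnorm (ν * t) (mul_nonneg hν ht)

/-- Strong continuity of the rescaled semigroup. [folklore] -/
theorem continuous_T_mul (ν : ℝ) : ∀ y : Hsp, Continuous fun t : ℝ => F.T (ν * t) y := fun y =>
  (F.hTc y).comp (continuous_const.mul continuous_id)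

/-- The weakly singular bound `‖K(ν t)‖ ≤ ν^{-3/4} t^{-3/4}` of the rescaled smoothing family. [folklore] -/
theorem norm_K_mul_le {ν : ℝ} (hν : 0 < ν) :
    ∀ t : ℝ, 0 < t → ‖F.K (ν * t)‖ ≤ ν ^ (-(3 / 4 : ℝ)) * t ^ (-(3 / 4 : ℝ)) := fun t ht => by
  rw [← Real.mul_rpow hν.le ht.le]; exact F.hKnorm _ (mul_pos hν ht)

/-- The intertwining `K(ν (s + t)) = T(ν s) ∘ K(ν t)` of the rescaled families. [folklore] -/
theorem K_mul_add {ν : ℝ} (hν : 0 < ν) :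
    ∀ s t : ℝ, 0 ≤ s → 0 < t → F.K (ν * (s + t)) = (F.T (ν * s)).comp (F.K (ν * t)) := fun s t hs ht => by
  rw [mul_add]; exact F.hKadd _ _ (mul_nonneg hν.le hs) (mul_pos hν ht)

/-- Strong continuity on `(0, ∞)` of the rescaled smoothing family. [folklore] -/
theorem continuousOn_K_mul {ν : ℝ} (hν : 0 < ν) :
    ∀ y : Hsp, ContinuousOn (fun t : ℝ => F.K (ν * t) y) (Ioi 0) := fun y =>
  (F.hKc y).comp (continuous_const.mul continuous_id).continuousOn fun _ ht => mul_pos hν ht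

end FrameLaws

section MildCurves

variable {F : ModelFrame} {ν : ℝ} {xf : Hsp}

/-- A mild solution starts at its datum: `z 0 = y`. [folklore] -/
theorem IsMild.apply_zero {t : ℝ} {ht : 0 ≤ t} {y : Hsp} {z : C(Icc (0 : ℝ) t, Hsp)} (hz : F.IsMild ν xf ht y z) :
    z ⟨0, left_mem_Icc.2 ht⟩ = y :=
  mild_apply_zero (fun r => F.T (ν * r)) (fun r => F.K (ν * r)) (F.T_mul_zero ν) F.Nb xf ht hz

/-- The constant curve is the mild solution on the degenerate interval `[0, 0]`. [folklore] -/
theorem isMild_const (F : ModelFrame) (ν : ℝ) (xf y : Hsp) :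
    F.IsMild ν xf le_rfl y (ContinuousMap.const (Icc (0 : ℝ) 0) y) :=
  mild_const (fun r => F.T (ν * r)) (fun r => F.K (ν * r)) (F.T_mul_zero ν) F.Nb xf y

/-- **Uniqueness of mild solutions** of the frame-conjugated equation on `[0, t]` (Henry 1981, Thm. 3.3.3: Lipschitz
stability by the singular Grönwall inequality, `Literature.Analysis.UnboundedOperators.mild_unique`). [folklore] -/
theorem IsMild.unique (hν : 0 < ν) {t : ℝ} {ht : 0 ≤ t} {y : Hsp} {z₁ z₂ : C(Icc (0 : ℝ) t, Hsp)}
    (h₁ : F.IsMild ν xf ht y z₁) (h₂ : F.IsMild ν xf ht y z₂) : z₁ = z₂ :=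
  mild_unique (fun r => F.T (ν * r)) (fun r => F.K (ν * r)) (F.norm_T_mul_le hν.le) (α := 3 / 4)
    (C := ν ^ (-(3 / 4 : ℝ))) (by norm_num) (Real.rpow_nonneg hν.le _) (F.norm_K_mul_le hν)
    (F.continuousOn_K_mul hν) F.Nb xf ht h₁ h₂

/-- **Restriction** of a mild solution on `[0, t]` to `[0, t']`, `t' ≤ t`. [folklore] -/
theorem IsMild.restrict {t t' : ℝ} {ht : 0 ≤ t} (ht' : 0 ≤ t') (htt' : t' ≤ t) {y : Hsp} {z : C(Icc (0 : ℝ) t, Hsp)}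
    (hz : F.IsMild ν xf ht y z) :
    ∃ z' : C(Icc (0 : ℝ) t', Hsp), F.IsMild ν xf ht' y z' ∧ ∀ r : Icc (0 : ℝ) t', z' r = z ⟨r, r.2.1, r.2.2.trans htt'⟩ :=
  exists_mild_restrict (fun r => F.T (ν * r)) (fun r => F.K (ν * r)) F.Nb xf ht ht' htt' hz

/-- **Shift** of a mild solution on `[0, τ]`, `τ = s + t`: `r ↦ z (t + r)` is a mild solution on `[0, s]` from `z t`
(`Literature.Analysis.UnboundedOperators.exists_mild_shift`). [folklore] -/
theorem IsMild.shift (hν : 0 < ν) {t s τ : ℝ} (ht : 0 ≤ t) (hs : 0 ≤ s) {hτ0 : 0 ≤ τ} (hτ : s + t = τ) {y : Hsp}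
    {z : C(Icc (0 : ℝ) τ, Hsp)} (hz : F.IsMild ν xf hτ0 y z) :
    ∃ w : C(Icc (0 : ℝ) s, Hsp), F.IsMild ν xf hs (z ⟨t, ht, (le_add_of_nonneg_left hs).trans_eq hτ⟩) w ∧
      ∀ r : Icc (0 : ℝ) s, w r = z (projIcc 0 τ hτ0 (t + r)) :=
  exists_mild_shift (fun r => F.T (ν * r)) (fun r => F.K (ν * r)) (α := 3 / 4) (C := ν ^ (-(3 / 4 : ℝ)))
    (by norm_num) (F.T_mul_add hν.le) (F.continuous_T_mul ν) (F.norm_K_mul_le hν) (F.K_mul_add hν)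
    (F.continuousOn_K_mul hν) F.Nb xf ht hs hτ0 hτ hz

/-- **Concatenation** of a mild solution `z` on `[0, t]` from `y` with a mild solution `w` on `[0, s]` from `z t`: a mild
solution on `[0, τ]`, `τ = s + t`, from `y`, equal to `z` on `[0, t]` and to `w (· − t)` on `[t, τ]`
(`Literature.Analysis.UnboundedOperators.exists_mild_concat`). [folklore] -/
theorem IsMild.concat (hν : 0 < ν) {t s τ : ℝ} {ht : 0 ≤ t} {hs : 0 ≤ s} (hτ0 : 0 ≤ τ) (hτ : s + t = τ) {y : Hsp}
    {z : C(Icc (0 : ℝ) t, Hsp)} {w : C(Icc (0 : ℝ) s, Hsp)} (hz : F.IsMild ν xf ht y z)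
    (hw : F.IsMild ν xf hs (z ⟨t, right_mem_Icc.2 ht⟩) w) :
    ∃ Z : C(Icc (0 : ℝ) τ, Hsp), F.IsMild ν xf hτ0 y Z ∧ (∀ r : Icc (0 : ℝ) τ, (r : ℝ) ≤ t → Z r = z (projIcc 0 t ht r)) ∧
      ∀ r : Icc (0 : ℝ) τ, t ≤ (r : ℝ) → Z r = w (projIcc 0 s hs ((r : ℝ) - t)) :=
  exists_mild_concat (fun r => F.T (ν * r)) (fun r => F.K (ν * r)) (F.T_mul_zero ν) (α := 3 / 4)
    (C := ν ^ (-(3 / 4 : ℝ))) (by norm_num) (F.T_mul_add hν.le) (F.continuous_T_mul ν) (F.norm_K_mul_le hν)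
    (F.K_mul_add hν) (F.continuousOn_K_mul hν) F.Nb xf ht hs hτ0 hτ hz hw

end MildCurves

section ModelMap

variable (F : ModelFrame) {ν : ℝ} {xf : Hsp} {U' : Set Hsp}

/-- **The model map is computed by any admissible solution**: if `z` is a mild solution on `[0, t]` from `y` staying in `U'`,
then `g t y = z t` (definition + uniqueness). [folklore] -/
theorem modelMap_eq_of_isMild (hν : 0 < ν) {t : ℝ} (ht : 0 ≤ t) {y : Hsp} {z : C(Icc (0 : ℝ) t, Hsp)}
    (hz : F.IsMild ν xf ht y z) (hU : ∀ r, z r ∈ U') : F.modelMap ν xf U' t y = z ⟨t, right_mem_Icc.2 ht⟩ := by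
  have h : ∃ z : C(Icc (0 : ℝ) t, Hsp), F.IsMild ν xf ht y z ∧ ∀ r, z r ∈ U' := ⟨z, hz, hU⟩
  rw [modelMap, dif_pos ht, dif_pos h, h.choose_spec.1.unique hν hz]

/-- **The junk value**: with no admissible solution on `[0, t]` from `y`, `g t y = 0`. [folklore] -/
theorem modelMap_eq_zero {t : ℝ} (ht : 0 ≤ t) {y : Hsp}
    (h : ¬∃ z : C(Icc (0 : ℝ) t, Hsp), F.IsMild ν xf ht y z ∧ ∀ r, z r ∈ U') : F.modelMap ν xf U' t y = 0 := by
  rw [modelMap, dif_pos ht, dif_neg h]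

/-- **`g 0 = id` on `U'`**: the constant curve is the admissible solution on `[0, 0]`, and every mild solution starts at
its datum. [folklore] -/
theorem modelMap_zero_apply (ν : ℝ) (xf : Hsp) {y : Hsp} (hy : y ∈ U') : F.modelMap ν xf U' 0 y = y := by
  have h : ∃ z : C(Icc (0 : ℝ) 0, Hsp), F.IsMild ν xf le_rfl y z ∧ ∀ r, z r ∈ U' :=
    ⟨_, F.isMild_const ν xf y, fun _ => hy⟩
  rw [modelMap, dif_pos le_rfl, dif_pos h]
  exact h.choose_spec.1.apply_zero

/-- **Admissible solutions along an orbit segment** (N-programme §7, Step A): if short-time (`≤ 3`) admissible solutions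
exist from every point of `U ⊆ U'` and the model orbit `r ↦ g r y` of `y ∈ U` stays in `U` on `[0, t]`, `t ≤ 3n`, then an
admissible mild solution on `[0, t]` from `y` exists — induction on `n`, concatenating a solution on `[0, 3n]` (whose endpoint
is `g (3n) y ∈ U` by uniqueness) with a short-time solution from that endpoint. [folklore] -/
theorem exists_isMild_of_forall_modelMap_mem (hν : 0 < ν) {U : Set Hsp} (hUU' : U ⊆ U')
    (htube : ∀ y ∈ U, ∀ t ∈ Icc (0 : ℝ) 3, ∃ (ht : 0 ≤ t) (z : C(Icc (0 : ℝ) t, Hsp)), F.IsMild ν xf ht y z ∧ ∀ r, z r ∈ U')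
    (n : ℕ) : ∀ {t : ℝ} (ht : 0 ≤ t), t ≤ 3 * n → ∀ {y : Hsp}, y ∈ U → (∀ r ∈ Icc 0 t, F.modelMap ν xf U' r y ∈ U) →
      ∃ z : C(Icc (0 : ℝ) t, Hsp), F.IsMild ν xf ht y z ∧ ∀ r, z r ∈ U' := by
  induction n with
  | zero =>
    intro t ht ht0 y hy _
    obtain rfl : t = 0 := le_antisymm (by simpa using ht0) ht
    exact ⟨_, F.isMild_const ν xf y, fun _ => hUU' hy⟩
  | succ n ih =>
    intro t ht htn y hy horb
    by_cases h : t ≤ 3 * n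
    · exact ih ht h hy horb
    rw [not_le] at h
    have ht₀ : (0 : ℝ) ≤ 3 * n := by positivity
    obtain ⟨z₀, hz₀, hz₀U⟩ := ih ht₀ le_rfl hy fun r hr => horb r ⟨hr.1, hr.2.trans h.le⟩
    have hmem : z₀ ⟨3 * n, right_mem_Icc.2 ht₀⟩ ∈ U := by
      rw [← F.modelMap_eq_of_isMild hν ht₀ hz₀ hz₀U]
      exact horb _ ⟨ht₀, h.le⟩
    obtain ⟨hs, w, hw, hwU⟩ := htube _ hmem (t - 3 * n) ⟨sub_nonneg.2 h.le, by push_cast at htn; linarith⟩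
    obtain ⟨Z, hZ, hZ₁, hZ₂⟩ := hz₀.concat hν ht (sub_add_cancel t (3 * n)) hw
    refine ⟨Z, hZ, fun r => ?_⟩
    rcases le_total (r : ℝ) (3 * n) with hr | hr
    · rw [hZ₁ r hr]; exact hz₀U _
    · rw [hZ₂ r hr]; exact hwU _

end ModelMap

end ModelFrame

/-- **Tools stub S6b of block N (`stub_modelSemigroupTools`) — the exact local semigroup law of the model map.**  Let
`F` be a model frame, `ν > 0`, `xF` the frame forcing, `U ⊆ U'`, and suppose that from every `y ∈ U` and for every
`t ∈ [0, 3]` there is a mild solution on `[0, t]` staying in `U'`.  Then the model map `g t := F.modelMap ν xF U' t`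
satisfies `g 0 y = y` on `U'`, and for `s, t ≥ 0`, `y ∈ U` whose model orbit stays in `U` on `[0, t]`,
`g (s + t) y = g s (g t y)` — exactly, junk cases included: an admissible solution `z` on `[0, t]` exists (induction over
windows of length `3`), `g t y = z t`; if an admissible solution `w` on `[0, s]` from `z t` exists both sides equal `w s`
(concatenation + uniqueness), otherwise both sides are the junk `0` (a solution on `[0, s + t]` would restrict to `z` by
uniqueness and shift to an admissible solution from `z t`). [folklore] -/
theorem stub_modelSemigroupTools (F : ModelFrame) {ν : ℝ} (hν : 0 < ν) (xF : Hsp) {U U' : Set Hsp} (hUU' : U ⊆ U')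
    (htube : ∀ y ∈ U, ∀ t ∈ Icc (0 : ℝ) 3, ∃ (ht : 0 ≤ t) (z : C(Icc (0 : ℝ) t, Hsp)), F.IsMild ν xF ht y z ∧ ∀ r, z r ∈ U') :
    (∀ y ∈ U', F.modelMap ν xF U' 0 y = y) ∧
    (∀ s t : ℝ, 0 ≤ s → 0 ≤ t → ∀ y ∈ U, (∀ r ∈ Icc 0 t, F.modelMap ν xF U' r y ∈ U) →
      F.modelMap ν xF U' (s + t) y = F.modelMap ν xF U' s (F.modelMap ν xF U' t y)) := by
  refine ⟨fun y hy => F.modelMap_zero_apply ν xF hy, fun s t hs ht y hy horb => ?_⟩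
  -- Step A: an admissible solution `z` on `[0, t]` from `y`; `g t y = z t`
  obtain ⟨z, hz, hzU⟩ := F.exists_isMild_of_forall_modelMap_mem hν hUU' htube ⌈t⌉₊ ht
    ((Nat.le_ceil t).trans (le_mul_of_one_le_left (Nat.cast_nonneg _) (by norm_num))) hy horb
  rw [F.modelMap_eq_of_isMild hν ht hz hzU]
  by_cases hex : ∃ w : C(Icc (0 : ℝ) s, Hsp), F.IsMild ν xF hs (z ⟨t, right_mem_Icc.2 ht⟩) w ∧ ∀ r, w r ∈ U'
  · -- Case 1: the second leg is admissible; both sides are its endpoint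
    obtain ⟨w, hw, hwU⟩ := hex
    obtain ⟨Z, hZ, hZ₁, hZ₂⟩ := hz.concat hν (add_nonneg hs ht) rfl hw
    have hZU : ∀ r, Z r ∈ U' := fun r => by
      rcases le_total (r : ℝ) t with hr | hr
      · rw [hZ₁ r hr]; exact hzU _
      · rw [hZ₂ r hr]; exact hwU _
    rw [F.modelMap_eq_of_isMild hν hs hw hwU, F.modelMap_eq_of_isMild hν (add_nonneg hs ht) hZ hZU,
      hZ₂ _ (le_add_of_nonneg_left hs)]
    simp only [add_sub_cancel_right, projIcc_right]
  · -- Case 2: no admissible second leg; both sides are the junk `0`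
    rw [F.modelMap_eq_zero hs hex, F.modelMap_eq_zero (add_nonneg hs ht)]
    rintro ⟨Z, hZ, hZU⟩
    obtain ⟨Z', hZ', hZ'eq⟩ := hZ.restrict ht (le_add_of_nonneg_left hs)
    have hZt : Z ⟨t, ht, le_add_of_nonneg_left hs⟩ = z ⟨t, right_mem_Icc.2 ht⟩ := by
      rw [← hZ'.unique hν hz, hZ'eq ⟨t, right_mem_Icc.2 ht⟩]
    obtain ⟨w, hw, hweq⟩ := hZ.shift hν ht hs rfl
    rw [hZt] at hw
    exact hex ⟨w, hw, fun r => (hweq r).symm ▸ hZU _⟩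

end Summit.AnomalousDissipation.AnomalousDissipation.Theorems.DenseLoudDesignerForces.Ergodic

end
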